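import Literature.NumberTheory.GaloisRepresentations.GalLayerSystemIdele
import Literature.NumberTheory.GaloisRepresentations.AbsGaloisGroup
import Literature.Algebra.Homology.DiscreteRepLayerColimitGroupCohomology
import HarnessLib

/-!
# `Extⁿ_{C_Γ}(ℤ, lim→_E S_E) = lim→_E Hⁿ(Gal(E/F), S_E)` along the inflations of the system — door-c4's colimit theorem
# (d) re-indexed by the finite Galois layers (Serre, *Galois Cohomology* I §2.2 Prop. 8; Tate, C–F VII §11.1)

Topic `NumberTheory/GaloisRepresentations`; namespace `Literature.NumberTheory.GaloisRepresentations.GalLayerData`.  Sequel to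
`GalLayerSystemIdele.lean` (door-c5 g16: `GalLayerData`, `D.layerCohomologyIso`, `D.inf`, `map_invariantsStepIncl_comp_layerCohomologyIso`,
the systems `ideleData`/`classData` with `ideleData_inf = ideleInf`, `classData_inf = classInf`) and door-c4's
`DiscreteRepLayerColimitGroupCohomology.lean` (`inflG`, `stepG`, `exists_inflG_eq`, `exists_stepG_eq_zero`, `inflG_stepG`,
`inflG_injective_zero/one`).  One definition with a body (`inflLayer`) and theorems; NO named fact, no `sorry`, no instance, no
notation.  Route A of crux `AnticycControlAdditiveK` (item 19295).

Mathematics.  For a Galois layer system `D` over a number field `F`, door-c4's theorem `Extⁿ_{C_Γ}(ℤ, M) = lim→_U Hⁿ(Γ⧸U, M^U)`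
(`M = lim→ D`, `U` open normal in `Γ_F`) becomes, through the dictionary `U = U_E ↔ E` and the layer isomorphisms
`Hⁿ(Γ_F⧸U_E, (lim D)^{U_E}) ≅ Hⁿ(Gal(E/F), D.obj E)` under which `stepG` is the inflation `D.inf` of the system:
**`Extⁿ_{C_Γ}(ℤ, lim→ D) = lim→_E Hⁿ(Gal(E/F), D.obj E)`** along the inflations — every class is inflated from a layer
(`exists_inflLayer_eq`), a layer class dies in the limit iff it dies under some inflation (`exists_inf_eq_zero`), two layer classes
agree in the limit iff they agree after some inflation (`exists_inf_eq_inf`), in degrees `0`, `1` the inflations are injective, and the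
limit vanishes iff every layer class dies deeper.  For `D = classData F` the inflations are the cell's `classInf F E E' n`, for
`D = ideleData F` they are `ideleInf F E E' n` (Tate VII §11.1: `H²(K̄/K) = lim→ H²(L/K)` along inflation, for `L*`, `J_L`, `C_L`).

## What is formalised (`F : Type` a number field, `Γ = absoluteGaloisGroup F`, `D : GalLayerData F`)

* **`D.inflLayer E n : Hⁿ(Gal(E/F), D.obj E) →+ Extⁿ_{C_Γ}(ℤ, lim→ D)`** (`= inflG U_E ∘ (layerCohomologyIso E n)⁻¹`), `inflLayer_apply`,
  `layerCohomologyIso_inv_inf` (`iso⁻¹ ∘ D.inf = stepG ∘ iso⁻¹`), **`inflLayer_inf`** (`inflLayer E' (D.inf h c) = inflLayer E c`).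
* **`exists_inflLayer_eq`**, **`exists_inf_eq_zero`**, **`exists_inf_eq_inf`**, `inflLayer_injective_zero`, `inflLayer_injective_one`,
  **`ext_triv_eq_zero_of_forall_exists_inf_eq_zero`**, `forall_ext_triv_eq_zero_iff`.
* Instances: `classData_inflLayer_classInf` (`inflLayer E' (classInf F E E' n c) = inflLayer E c`), `ideleData_inflLayer_ideleInf`.

## References
* J.-P. Serre, *Galois Cohomology*, Springer (1997), I §2.2 Proposition 8. [SerreGaloisCohomology1997]
* J. W. S. Cassels, A. Fröhlich (eds.), *Algebraic Number Theory* (1967), Ch. VII (J. Tate) §11.1. [CasselsFrohlichANT1967]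
-/

noncomputable section

open CategoryTheory CategoryTheory.Limits CategoryTheory.Abelian NumberField groupCohomology
open Field (absoluteGaloisGroup)
open Literature.Algebra.Homology
open scoped Classical

namespace Literature.NumberTheory.GaloisRepresentations

open IdeleClassBar

namespace GalLayerData

variable {F : Type} [Field F] [NumberField F] (D : GalLayerData F)

/-! ## Inflation from a layer `E` to `Extⁿ_{C_Γ}(ℤ, lim→ D)` -/

/-- **Inflation from the layer `E`: `Hⁿ(Gal(E/F), D.obj E) →+ Extⁿ_{C_Γ}(ℤ, lim→ D)`** — door-c4's `inflG U_E` composed with the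
layer isomorphism `Hⁿ(Γ_F⧸U_E, (lim D)^{U_E}) ≅ Hⁿ(Gal(E/F), D.obj E)`. [cite: SerreGaloisCohomology1997, I §2.2 Proposition 8] -/
def inflLayer (E : GalLayer F) (n : ℕ) :
    groupCohomology (D.obj E) n →+ Ext (DiscreteRep.triv (Γ := absoluteGaloisGroup F) ℤ) D.toSystem.toD n :=
  (DiscreteRep.LayerColimit.inflG E.openNormalSubgroup D.toSystem.toD n).comp
    (D.layerCohomologyIso E n).toLinearEquiv.symm.toAddMonoidHom

/-- Formula. [cite: SerreGaloisCohomology1997, I §2.2 Proposition 8] -/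
theorem inflLayer_apply (E : GalLayer F) (n : ℕ) (c : groupCohomology (D.obj E) n) :
    D.inflLayer E n c = DiscreteRep.LayerColimit.inflG E.openNormalSubgroup D.toSystem.toD n
      ((D.layerCohomologyIso E n).inv c) := rfl

/-- `inflLayer E (iso c') = inflG U_E c'` for a class `c'` of door-c4's layer. [cite: SerreGaloisCohomology1997, I §2.2 Proposition 8] -/
theorem inflLayer_layerCohomologyIso_hom (E : GalLayer F) (n : ℕ) (c' : groupCohomology (D.layerRep E) n) :
    D.inflLayer E n ((D.layerCohomologyIso E n).hom c') =
      DiscreteRep.LayerColimit.inflG E.openNormalSubgroup D.toSystem.toD n c' := by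
  rw [inflLayer_apply, Iso.hom_inv_id_apply]

/-- **`iso_{E'}⁻¹ ∘ D.inf = stepG ∘ iso_E⁻¹`**: the inverse form of `map_invariantsStepIncl_comp_layerCohomologyIso`.
[cite: SerreGaloisCohomology1997, I §2.2 Proposition 8] -/
theorem layerCohomologyIso_inv_inf {E E' : GalLayer F} (h : E ≤ E') (n : ℕ) (c : groupCohomology (D.obj E) n) :
    (D.layerCohomologyIso E' n).inv (D.inf h n c) =
      DiscreteRep.LayerColimit.stepG E.openNormalSubgroup E'.openNormalSubgroup (GalLayer.coe_openNormalSubgroup_le h)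
        D.toSystem.toD n ((D.layerCohomologyIso E n).inv c) := by
  have hsq : (D.layerCohomologyIso E' n).hom
      (DiscreteRep.LayerColimit.stepG E.openNormalSubgroup E'.openNormalSubgroup (GalLayer.coe_openNormalSubgroup_le h)
        D.toSystem.toD n ((D.layerCohomologyIso E n).inv c)) = D.inf h n c := by
    have h1 := congrArg (fun φ : groupCohomology (D.layerRep E) n ⟶ groupCohomology (D.obj E') n =>
      φ ((D.layerCohomologyIso E n).inv c)) (D.map_invariantsStepIncl_comp_layerCohomologyIso h n)
    change (D.layerCohomologyIso E' n).hom
        (DiscreteRep.LayerColimit.stepG E.openNormalSubgroup E'.openNormalSubgroup (GalLayer.coe_openNormalSubgroup_le h)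
          D.toSystem.toD n ((D.layerCohomologyIso E n).inv c)) =
      D.inf h n ((D.layerCohomologyIso E n).hom ((D.layerCohomologyIso E n).inv c)) at h1
    rwa [Iso.inv_hom_id_apply] at h1
  rw [← hsq, Iso.hom_inv_id_apply]

/-- **The inflations are compatible with the system: `inflLayer E' (D.inf h c) = inflLayer E c`** (door-c4's
`inflG_stepG`). [cite: SerreGaloisCohomology1997, I §2.2 Proposition 8] -/
theorem inflLayer_inf {E E' : GalLayer F} (h : E ≤ E') (n : ℕ) (c : groupCohomology (D.obj E) n) :
    D.inflLayer E' n (D.inf h n c) = D.inflLayer E n c := by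
  rw [inflLayer_apply, layerCohomologyIso_inv_inf, DiscreteRep.LayerColimit.inflG_stepG, inflLayer_apply]

/-! ## (d) along the finite Galois layers -/

/-- **Every class of `Extⁿ_{C_Γ}(ℤ, lim→ D)` is inflated from some layer `Hⁿ(Gal(E/F), D.obj E)`.**
[cite: SerreGaloisCohomology1997, I §2.2 Proposition 8] -/
theorem exists_inflLayer_eq (n : ℕ) (x : Ext (DiscreteRep.triv (Γ := absoluteGaloisGroup F) ℤ) D.toSystem.toD n) :
    ∃ (E : GalLayer F) (c : groupCohomology (D.obj E) n), D.inflLayer E n c = x := by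
  obtain ⟨U, c', rfl⟩ := DiscreteRep.LayerColimit.exists_inflG_eq n D.toSystem.toD x
  obtain ⟨E, rfl⟩ : ∃ E : GalLayer F, E.openNormalSubgroup = U :=
    ⟨_, GalLayer.openNormalSubgroup_ofOpenNormalSubgroup U⟩
  exact ⟨E, (D.layerCohomologyIso E n).hom c', D.inflLayer_layerCohomologyIso_hom E n c'⟩

/-- **A layer class dying in the limit dies under some inflation of the system.** [cite: SerreGaloisCohomology1997, I §2.2 Proposition 8] -/
theorem exists_inf_eq_zero (n : ℕ) (E : GalLayer F) (c : groupCohomology (D.obj E) n) (hc : D.inflLayer E n c = 0) :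
    ∃ (E' : GalLayer F) (h : E ≤ E'), D.inf h n c = 0 := by
  obtain ⟨V, hVU, hV⟩ := DiscreteRep.LayerColimit.exists_stepG_eq_zero n D.toSystem.toD E.openNormalSubgroup
    ((D.layerCohomologyIso E n).inv c) hc
  obtain ⟨E', rfl⟩ : ∃ E' : GalLayer F, E'.openNormalSubgroup = V :=
    ⟨_, GalLayer.openNormalSubgroup_ofOpenNormalSubgroup V⟩
  have h : E ≤ E' := GalLayer.openNormalSubgroup_le_iff.1 hVU
  refine ⟨E', h, (D.layerCohomologyIso E' n).toLinearEquiv.symm.injective ?_⟩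
  change (D.layerCohomologyIso E' n).inv (D.inf h n c) = (D.layerCohomologyIso E' n).inv 0
  rw [map_zero, layerCohomologyIso_inv_inf]
  exact hV

/-- **Two layer classes with the same image in the limit agree after some inflation.**
[cite: SerreGaloisCohomology1997, I §2.2 Proposition 8] -/
theorem exists_inf_eq_inf (n : ℕ) (E : GalLayer F) (c c' : groupCohomology (D.obj E) n)
    (h : D.inflLayer E n c = D.inflLayer E n c') : ∃ (E' : GalLayer F) (hE : E ≤ E'), D.inf hE n c = D.inf hE n c' := by
  obtain ⟨E', hE, h0⟩ := D.exists_inf_eq_zero n E (c - c') (by rw [map_sub, h, sub_self])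
  exact ⟨E', hE, sub_eq_zero.1 (by rw [← map_sub, h0])⟩

/-- In degree `0` the inflation from every layer is injective. [cite: SerreGaloisCohomology1997, I §2.2 Proposition 8] -/
theorem inflLayer_injective_zero (E : GalLayer F) : Function.Injective (D.inflLayer E 0) :=
  (DiscreteRep.LayerColimit.inflG_injective_zero D.toSystem.toD E.openNormalSubgroup).comp
    (D.layerCohomologyIso E 0).toLinearEquiv.symm.injective

/-- **In degree `1` the inflation from every layer is injective** (inflation–restriction).
[cite: SerreGaloisCohomology1997, I §2.2 Proposition 8] -/
theorem inflLayer_injective_one (E : GalLayer F) : Function.Injective (D.inflLayer E 1) :=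
  (DiscreteRep.LayerColimit.inflG_injective_one D.toSystem.toD E.openNormalSubgroup).comp
    (D.layerCohomologyIso E 1).toLinearEquiv.symm.injective

/-- **Vanishing transfer along the layers**: if every class of every `Hⁿ(Gal(E/F), D.obj E)` is killed by some inflation of the
system, then `Extⁿ_{C_Γ}(ℤ, lim→ D) = 0` (Milne ADT I Lemma 1.9 (b) / Harari Lemma 16.20 shape).
[cite: SerreGaloisCohomology1997, I §2.2 Proposition 8] -/
theorem ext_triv_eq_zero_of_forall_exists_inf_eq_zero (n : ℕ)
    (h : ∀ (E : GalLayer F) (c : groupCohomology (D.obj E) n), ∃ (E' : GalLayer F) (hE : E ≤ E'), D.inf hE n c = 0)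
    (x : Ext (DiscreteRep.triv (Γ := absoluteGaloisGroup F) ℤ) D.toSystem.toD n) : x = 0 := by
  obtain ⟨E, c, rfl⟩ := D.exists_inflLayer_eq n x
  obtain ⟨E', hE, h0⟩ := h E c
  rw [← D.inflLayer_inf hE, h0, map_zero]

/-- The limit group vanishes iff every layer class dies under some inflation of the system.
[cite: SerreGaloisCohomology1997, I §2.2 Proposition 8] -/
theorem forall_ext_triv_eq_zero_iff (n : ℕ) :
    (∀ x : Ext (DiscreteRep.triv (Γ := absoluteGaloisGroup F) ℤ) D.toSystem.toD n, x = 0) ↔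
      ∀ (E : GalLayer F) (c : groupCohomology (D.obj E) n), ∃ (E' : GalLayer F) (hE : E ≤ E'), D.inf hE n c = 0 :=
  ⟨fun hx E c => D.exists_inf_eq_zero n E c (hx _), fun h x => D.ext_triv_eq_zero_of_forall_exists_inf_eq_zero n h x⟩

end GalLayerData

/-! ## The idèle class formation: inflations `classInf`, `ideleInf` -/

variable {F : Type} [Field F] [NumberField F]

/-- **`Ext²_{C_Γ}(ℤ, C̄) = lim→_E H²(Gal(E/F), C_E)` along `classInf`**: the inflation from `C_E` to the limit is compatible with
the cell's `classInf` (all degrees). [cite: CasselsFrohlichANT1967, Ch. VII §11.1] -/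
theorem classData_inflLayer_classInf {E E' : GalLayer F} (h : E ≤ E') (n : ℕ)
    (c : groupCohomology ((classData F).obj E) n) :
    (classData F).inflLayer E' n
        ((haveI := E.numberField; haveI := E'.numberField; haveI := E.isGalois; letI := GalLayer.algebraOfLE h;
          haveI := GalLayer.isScalarTower_of_le h; IdeleCohomology.classInf F E.1 E'.1 n) c) =
      (classData F).inflLayer E n c := by
  rw [← classData_inf h n]
  exact (classData F).inflLayer_inf h n c

/-- **`Extⁿ_{C_Γ}(ℤ, J̄) = lim→_E Hⁿ(Gal(E/F), J_E)` along `ideleInf`.** [cite: CasselsFrohlichANT1967, Ch. VII §11.1] -/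
theorem ideleData_inflLayer_ideleInf {E E' : GalLayer F} (h : E ≤ E') (n : ℕ)
    (c : groupCohomology ((ideleData F).obj E) n) :
    (ideleData F).inflLayer E' n
        ((haveI := E.numberField; haveI := E'.numberField; haveI := E.isGalois; letI := GalLayer.algebraOfLE h;
          haveI := GalLayer.isScalarTower_of_le h; IdeleCohomology.ideleInf F E.1 E'.1 n) c) =
      (ideleData F).inflLayer E n c := by
  rw [← ideleData_inf h n]
  exact (ideleData F).inflLayer_inf h n c

end Literature.NumberTheory.GaloisRepresentations

end
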